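import Mathlib.MeasureTheory.Group.FundamentalDomain
import Mathlib.MeasureTheory.Constructions.Pi
import Mathlib.MeasureTheory.Measure.Lebesgue.Basic
import Literature.MathematicalPhysics.QuantumFieldTheory.TorusChartSpinWaveDomain
import HarnessLib

/-!
# The spin-wave sector as a sum over winding sectors of real-field integrals

The measure-theoretic form of the spin-wave lift (`TorusChartSpinWaveDomain.lean`) on a charted finite torus
`Λ`: for every integrand `f` on `Λ → ℝ` which is `2π`-periodic in each variable (e.g. the Gibbs factor of any
`XY`-type model, which only reads the angles `φ x mod 2π`),

  `∫_{φ ∈ [0,2π)^Λ, φ vortex-free} f φ dφ = Σ_{k ∈ ℤ^d} ∫_{liftDom k} f φ dφ`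

(`setIntegral_cubeIco_vortexFree_eq_tsum`; also with the closed cube `[0,2π]^Λ`,
`setIntegral_cubeIcc_vortexFree_eq_tsum`, and without the sum, `setIntegral_cubeIco_vortexFree_eq`).  Here
`liftDom k` is the winding sector `k`: real fields `φ` with `φ 0 ∈ [0,2π)` whose seam-corrected gradients
`d₀ φ + seam (2π k)` are principal values — so on `liftDom k` every `e^{i n (φ(x+e_i) - φ x)}` of the
integrand is a genuine function of the real gradient field, which is the starting point of the spin-wave
(Gaussian) analysis of the low-temperature phase.

Proof: the lattice `(2πℤ)^Λ` (`twoPiLattice Λ`, a countable subgroup of `Λ → ℝ`) acts by translations,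
preserving Lebesgue measure; the half-open cube `[0,2π)^Λ` is a fundamental domain
(`isAddFundamentalDomain_cubeIco`), and so is `(⋃_k liftDom k) ∪ ([0,2π)^Λ ∖ {vortex-free})`
(`isAddFundamentalDomain_liftSet_union`) by existence and uniqueness of the canonical lift
(`existsUnique_zsmul_add_mem_liftDom`); Mathlib's `IsAddFundamentalDomain.setIntegral_eq` transports the
integral of the invariant function `1_{vortex-free} · f` from one to the other.
-/

noncomputable section

namespace Literature.MathematicalPhysics.QuantumFieldTheory

open scoped BigOperators
open _root_.MeasureTheory _root_.MeasureTheory.Measure Set Real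

namespace TorusChart

/-! ## The lattice `(2πℤ)^Λ` and the half-open cube -/

section Lattice

variable (Λ : Type*)

/-- The lattice `(2πℤ)^Λ` of real fields with values in `2πℤ`, as a subgroup of `Λ → ℝ`. [folklore] -/
def twoPiLattice : AddSubgroup (Λ → ℝ) := AddSubgroup.pi Set.univ fun _ => AddSubgroup.zmultiples (2 * π)

/-- The half-open cube `[0, 2π)^Λ`. [folklore] -/
def cubeIco : Set (Λ → ℝ) := Set.pi Set.univ fun _ => Set.Ico 0 (2 * π)

/-- The closed cube `[0, 2π]^Λ`. [folklore] -/
def cubeIcc : Set (Λ → ℝ) := Set.pi Set.univ fun _ => Set.Icc 0 (2 * π)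

variable {Λ}

/-- Membership in the lattice. [folklore] -/
theorem mem_twoPiLattice_iff {m : Λ → ℝ} : m ∈ twoPiLattice Λ ↔ ∀ x, ∃ n : ℤ, n • (2 * π) = m x := by
  simp only [twoPiLattice, AddSubgroup.mem_pi, Set.mem_univ, true_implies, AddSubgroup.mem_zmultiples_iff]

/-- The lattice element `2π n` of an integer field `n`. [folklore] -/
def latticeOf (n : Λ → ℤ) : twoPiLattice Λ :=
  ⟨fun x => n x • (2 * π), mem_twoPiLattice_iff.2 fun x => ⟨n x, rfl⟩⟩

/-- The value of `latticeOf n`. [folklore] -/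
@[simp] theorem coe_latticeOf (n : Λ → ℤ) : ((latticeOf n : twoPiLattice Λ) : Λ → ℝ) = fun x => n x • (2 * π) :=
  rfl

/-- Every lattice element is `2π` times an integer field. [folklore] -/
theorem exists_eq_latticeOf (m : twoPiLattice Λ) : ∃ n : Λ → ℤ, m = latticeOf n := by
  have h := mem_twoPiLattice_iff.1 m.2
  choose n hn using h
  exact ⟨n, Subtype.ext (funext fun x => (hn x).symm)⟩

/-- `latticeOf` is surjective. [folklore] -/
theorem latticeOf_surjective : Function.Surjective (latticeOf (Λ := Λ)) := fun m =>
  let ⟨n, hn⟩ := exists_eq_latticeOf m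
  ⟨n, hn.symm⟩

/-- The lattice of a finite torus is countable. [folklore] -/
instance countable_twoPiLattice [Finite Λ] : Countable (twoPiLattice Λ) :=
  latticeOf_surjective.countable

/-- The action of a lattice element on a real field is pointwise addition. [folklore] -/
theorem vadd_apply (m : twoPiLattice Λ) (φ : Λ → ℝ) (x : Λ) : (m +ᵥ φ) x = (m : Λ → ℝ) x + φ x := rfl

/-- The action of `latticeOf n`: `φ ↦ φ + 2π n`. [folklore] -/
theorem latticeOf_vadd (n : Λ → ℤ) (φ : Λ → ℝ) : (latticeOf n +ᵥ φ) = fun x => φ x + n x • (2 * π) := by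
  funext x; rw [vadd_apply, coe_latticeOf, add_comm]

/-- A function of real fields which is `2π`-periodic in every variable is invariant under the lattice.
[folklore] -/
theorem invariant_of_periodic {β : Type*} {f : (Λ → ℝ) → β}
    (hf : ∀ (n : Λ → ℤ) (φ : Λ → ℝ), f (fun x => φ x + n x • (2 * π)) = f φ) (m : twoPiLattice Λ) (φ : Λ → ℝ) :
    f (m +ᵥ φ) = f φ := by
  obtain ⟨n, rfl⟩ := exists_eq_latticeOf m
  rw [latticeOf_vadd]; exact hf n φ

/-- The half-open cube is measurable. [folklore] -/
theorem measurableSet_cubeIco [Countable Λ] : MeasurableSet (cubeIco Λ) :=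
  MeasurableSet.univ_pi fun _ => measurableSet_Ico

/-- The closed cube is measurable. [folklore] -/
theorem measurableSet_cubeIcc [Countable Λ] : MeasurableSet (cubeIcc Λ) :=
  MeasurableSet.univ_pi fun _ => measurableSet_Icc

/-- **Reduction modulo `2π`**: every real field has exactly one `(2πℤ)^Λ`-translate in the half-open cube
`[0,2π)^Λ`. [folklore] -/
theorem existsUnique_vadd_mem_cubeIco (φ : Λ → ℝ) : ∃! m : twoPiLattice Λ, m +ᵥ φ ∈ cubeIco Λ := by
  refine ⟨latticeOf fun x => -toIcoDiv Real.two_pi_pos 0 (φ x), ?_, ?_⟩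
  · simp only [cubeIco, Set.mem_univ_pi, latticeOf_vadd]
    intro x
    have : φ x + (-toIcoDiv Real.two_pi_pos 0 (φ x)) • (2 * π) = toIcoMod Real.two_pi_pos 0 (φ x) := by
      rw [toIcoMod, neg_zsmul, sub_eq_add_neg]
    rw [this]
    exact toIcoMod_mem_Ico' _ _
  · intro m hm
    obtain ⟨n, rfl⟩ := exists_eq_latticeOf m
    simp only [cubeIco, Set.mem_univ_pi, latticeOf_vadd] at hm
    congr 1
    funext x
    have hx := hm x
    have h1 : toIcoMod Real.two_pi_pos 0 (φ x) = φ x + n x • (2 * π) := by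
      rw [toIcoMod_eq_iff]
      refine ⟨by rwa [zero_add], -n x, ?_⟩
      rw [neg_zsmul, add_neg_cancel_right]
    have h2 : toIcoMod Real.two_pi_pos 0 (φ x) = φ x + (-toIcoDiv Real.two_pi_pos 0 (φ x)) • (2 * π) := by
      rw [toIcoMod, neg_zsmul, sub_eq_add_neg]
    have := add_left_cancel (h1.symm.trans h2)
    rw [zsmul_eq_mul, zsmul_eq_mul] at this
    exact_mod_cast mul_right_cancel₀ Real.two_pi_pos.ne' this

/-- **The half-open cube `[0,2π)^Λ` is a fundamental domain for the lattice `(2πℤ)^Λ`.** [folklore] -/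
theorem isAddFundamentalDomain_cubeIco [Fintype Λ] :
    IsAddFundamentalDomain (twoPiLattice Λ) (cubeIco Λ) :=
  IsAddFundamentalDomain.mk' measurableSet_cubeIco.nullMeasurableSet existsUnique_vadd_mem_cubeIco

/-- The closed and the half-open cube agree almost everywhere. [folklore] -/
theorem cubeIco_ae_eq_cubeIcc [Fintype Λ] : cubeIco Λ =ᵐ[volume] cubeIcc Λ := by
  rw [volume_pi]
  exact Measure.pi_Ico_ae_eq_pi_Icc

end Lattice

/-! ## The lift set and the vortex-free set -/

variable {Λ : Type*} [AddCommGroup Λ] {d : ℕ} (F : TorusChart Λ d)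

/-- The **lift set**: the union of the lift domains of all winding sectors. [folklore] -/
def liftSet : Set (Λ → ℝ) := ⋃ k : Fin d → ℤ, F.liftDom k

/-- The **vortex-free set** of real fields. [folklore] -/
def vortexFreeSet : Set (Λ → ℝ) := {φ | F.IsVortexFree φ}

/-- Membership in the vortex-free set. [folklore] -/
@[simp] theorem mem_vortexFreeSet_iff (φ : Λ → ℝ) : φ ∈ F.vortexFreeSet ↔ F.IsVortexFree φ := Iff.rfl

/-- The lift set consists of vortex-free fields. [folklore] -/
theorem liftSet_subset_vortexFreeSet : F.liftSet ⊆ F.vortexFreeSet := by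
  rintro φ ⟨_, ⟨k, rfl⟩, hk⟩
  exact isVortexFree_of_mem_liftDom hk

/-- The vortex-free set is invariant under the lattice. [folklore] -/
theorem vadd_mem_vortexFreeSet_iff (m : twoPiLattice Λ) (φ : Λ → ℝ) :
    m +ᵥ φ ∈ F.vortexFreeSet ↔ φ ∈ F.vortexFreeSet := by
  obtain ⟨n, rfl⟩ := exists_eq_latticeOf m
  rw [latticeOf_vadd, mem_vortexFreeSet_iff, mem_vortexFreeSet_iff]
  exact F.isVortexFree_add_zsmul φ n

/-- The lift domains are measurable. [folklore] -/
theorem measurableSet_liftDom [Finite Λ] (k : Fin d → ℤ) : MeasurableSet (F.liftDom k) := by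
  have h1 : MeasurableSet {φ : Λ → ℝ | φ 0 ∈ Set.Ico 0 (2 * π)} :=
    measurableSet_Ico.preimage (measurable_pi_apply 0)
  have h2 : ∀ (x : Λ) (i : Fin d),
      MeasurableSet {φ : Λ → ℝ | F.d₀ φ x i + F.seam (twoPiSeam k) x i ∈ Set.Ioc (-π) π} := fun x i => by
    have hm : Measurable fun φ : Λ → ℝ => F.d₀ φ x i + F.seam (twoPiSeam k) x i :=
      ((measurable_pi_apply (x + F.gen i)).sub (measurable_pi_apply x)).add_const _
    exact measurableSet_Ioc.preimage hm
  have : F.liftDom k = {φ : Λ → ℝ | φ 0 ∈ Set.Ico 0 (2 * π)} ∩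
      ⋂ x : Λ, ⋂ i : Fin d, {φ : Λ → ℝ | F.d₀ φ x i + F.seam (twoPiSeam k) x i ∈ Set.Ioc (-π) π} := by
    ext φ
    simp only [liftDom, Set.mem_setOf_eq, Set.mem_inter_iff, Set.mem_iInter]
  rw [this]
  exact h1.inter (MeasurableSet.iInter fun x => MeasurableSet.iInter fun i => h2 x i)

/-- The lift set is measurable. [folklore] -/
theorem measurableSet_liftSet [Finite Λ] : MeasurableSet F.liftSet :=
  MeasurableSet.iUnion fun k => F.measurableSet_liftDom k

/-- **The vortex-free set is the lattice saturation of the lift set.** [folklore] -/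
theorem vortexFreeSet_eq_iUnion : F.vortexFreeSet = ⋃ m : twoPiLattice Λ, (fun φ => m +ᵥ φ) ⁻¹' F.liftSet := by
  ext φ
  simp only [Set.mem_iUnion, Set.mem_preimage, mem_vortexFreeSet_iff]
  constructor
  · intro hφ
    obtain ⟨n, hn⟩ := exists_lift_eq_add_zsmul hφ
    refine ⟨latticeOf n, ?_⟩
    rw [latticeOf_vadd, show (fun x => φ x + n x • (2 * π)) = F.lift φ from (funext hn).symm]
    exact Set.mem_iUnion.2 ⟨F.liftWind φ, lift_mem_liftDom hφ⟩
  · rintro ⟨m, hm⟩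
    exact (F.vadd_mem_vortexFreeSet_iff m φ).1 (F.liftSet_subset_vortexFreeSet hm)

/-- The vortex-free set is measurable. [folklore] -/
theorem measurableSet_vortexFreeSet [Finite Λ] : MeasurableSet F.vortexFreeSet := by
  rw [vortexFreeSet_eq_iUnion]
  exact MeasurableSet.iUnion fun m => (measurable_const_vadd m) F.measurableSet_liftSet

/-- **The lift set, completed by the non-vortex-free part of the cube, is a fundamental domain for the
lattice**: a vortex-free field has exactly one translate in the lift set (its canonical lift) and none in the
complement of the vortex-free set; a field with vortices has none in the lift set and exactly one in the cube.
[folklore] -/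
theorem isAddFundamentalDomain_liftSet_union [Fintype Λ] :
    IsAddFundamentalDomain (twoPiLattice Λ) (F.liftSet ∪ (cubeIco Λ ∩ F.vortexFreeSetᶜ)) := by
  refine IsAddFundamentalDomain.mk'
    (F.measurableSet_liftSet.union (measurableSet_cubeIco.inter F.measurableSet_vortexFreeSet.compl)).nullMeasurableSet
    fun φ => ?_
  by_cases hφ : F.IsVortexFree φ
  · -- vortex-free: the canonical lift
    obtain ⟨n, ⟨k, hk⟩, huniq⟩ := existsUnique_zsmul_add_mem_liftDom hφ
    refine ⟨latticeOf n, Or.inl (by rw [latticeOf_vadd]; exact Set.mem_iUnion.2 ⟨k, hk⟩), ?_⟩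
    intro m hm
    obtain ⟨n', rfl⟩ := exists_eq_latticeOf m
    rcases hm with hm | hm
    · obtain ⟨_, ⟨k', rfl⟩, hk'⟩ := hm
      rw [latticeOf_vadd] at hk'
      rw [huniq n' ⟨k', hk'⟩]
    · exact absurd ((F.vadd_mem_vortexFreeSet_iff _ φ).2 hφ) hm.2
  · -- vortices: the reduction modulo `2π`
    obtain ⟨m, hm, huniq⟩ := existsUnique_vadd_mem_cubeIco φ
    have hnot : ∀ m' : twoPiLattice Λ, m' +ᵥ φ ∉ F.liftSet := fun m' h' =>
      hφ ((F.vadd_mem_vortexFreeSet_iff m' φ).1 (F.liftSet_subset_vortexFreeSet h'))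
    refine ⟨m, Or.inr ⟨hm, fun h => hφ ((F.vadd_mem_vortexFreeSet_iff m φ).1 h)⟩, ?_⟩
    intro m' hm'
    rcases hm' with hm' | hm'
    · exact absurd hm' (hnot m')
    · exact huniq m' hm'.1

/-- The trace of the completed lift set on the vortex-free set is the lift set. [folklore] -/
theorem liftSet_union_inter_vortexFreeSet :
    (F.liftSet ∪ (cubeIco Λ ∩ F.vortexFreeSetᶜ)) ∩ F.vortexFreeSet = F.liftSet := by
  ext φ
  constructor
  · rintro ⟨h | h, hV⟩
    · exact h
    · exact absurd hV h.2
  · intro h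
    exact ⟨Or.inl h, F.liftSet_subset_vortexFreeSet h⟩

/-! ## The integral identity -/

variable {E : Type*} [NormedAddCommGroup E] [NormedSpace ℝ E]

/-- **The spin-wave sector as an integral over the lift set.** For an integrand `f` which is `2π`-periodic in
every variable, the integral over the vortex-free fields of the half-open cube equals the integral over the lift
set `⋃_k liftDom k`. [folklore] -/
theorem setIntegral_cubeIco_vortexFree_eq [Fintype Λ] (f : (Λ → ℝ) → E)
    (hf : ∀ (n : Λ → ℤ) (φ : Λ → ℝ), f (fun x => φ x + n x • (2 * π)) = f φ) :
    ∫ φ in cubeIco Λ ∩ F.vortexFreeSet, f φ = ∫ φ in F.liftSet, f φ := by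
  have hV := F.measurableSet_vortexFreeSet
  set g : (Λ → ℝ) → E := F.vortexFreeSet.indicator f with hg
  have hginv : ∀ (m : twoPiLattice Λ) (φ : Λ → ℝ), g (m +ᵥ φ) = g φ := fun m φ => by
    by_cases hφ : φ ∈ F.vortexFreeSet
    · rw [hg, Set.indicator_of_mem hφ, Set.indicator_of_mem ((F.vadd_mem_vortexFreeSet_iff m φ).2 hφ),
        invariant_of_periodic hf]
    · rw [hg, Set.indicator_of_notMem hφ, Set.indicator_of_notMem (mt (F.vadd_mem_vortexFreeSet_iff m φ).1 hφ)]
  have h := IsAddFundamentalDomain.setIntegral_eq (isAddFundamentalDomain_cubeIco (Λ := Λ))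
    F.isAddFundamentalDomain_liftSet_union (f := g) hginv
  rw [hg, setIntegral_indicator hV, setIntegral_indicator hV, liftSet_union_inter_vortexFreeSet] at h
  exact h

omit [NormedSpace ℝ E] in
/-- Integrability transfers from the cube to the lift set for `2π`-periodic integrands. [folklore] -/
theorem integrableOn_liftSet [Fintype Λ] {f : (Λ → ℝ) → E}
    (hf : ∀ (n : Λ → ℤ) (φ : Λ → ℝ), f (fun x => φ x + n x • (2 * π)) = f φ)
    (hfi : IntegrableOn f (cubeIco Λ) volume) : IntegrableOn f F.liftSet volume := by
  have hV := F.measurableSet_vortexFreeSet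
  set g : (Λ → ℝ) → E := F.vortexFreeSet.indicator f with hg
  have hginv : ∀ (m : twoPiLattice Λ) (φ : Λ → ℝ), g (m +ᵥ φ) = g φ := fun m φ => by
    by_cases hφ : φ ∈ F.vortexFreeSet
    · rw [hg, Set.indicator_of_mem hφ, Set.indicator_of_mem ((F.vadd_mem_vortexFreeSet_iff m φ).2 hφ),
        invariant_of_periodic hf]
    · rw [hg, Set.indicator_of_notMem hφ, Set.indicator_of_notMem (mt (F.vadd_mem_vortexFreeSet_iff m φ).1 hφ)]
  have hgi : IntegrableOn g (cubeIco Λ) volume := hfi.indicator hV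
  have h := (IsAddFundamentalDomain.integrableOn_iff (isAddFundamentalDomain_cubeIco (Λ := Λ))
    F.isAddFundamentalDomain_liftSet_union hginv).1 hgi
  rw [hg, IntegrableOn, integrable_indicator_iff hV, IntegrableOn, Measure.restrict_restrict hV, Set.inter_comm,
    liftSet_union_inter_vortexFreeSet] at h
  exact h

/-- **The spin-wave sector as a sum over winding sectors** (half-open cube): for an integrand `f` which is
`2π`-periodic in every variable and integrable on the cube,
`∫_{[0,2π)^Λ ∩ vortex-free} f = Σ_k ∫_{liftDom k} f`. [folklore] -/
theorem setIntegral_cubeIco_vortexFree_eq_tsum [Fintype Λ] (f : (Λ → ℝ) → E)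
    (hf : ∀ (n : Λ → ℤ) (φ : Λ → ℝ), f (fun x => φ x + n x • (2 * π)) = f φ)
    (hfi : IntegrableOn f (cubeIco Λ) volume) :
    ∫ φ in cubeIco Λ ∩ F.vortexFreeSet, f φ = ∑' k : Fin d → ℤ, ∫ φ in F.liftDom k, f φ := by
  rw [F.setIntegral_cubeIco_vortexFree_eq f hf, liftSet]
  exact integral_iUnion F.measurableSet_liftDom (fun k k' hkk' => F.disjoint_liftDom hkk')
    (F.integrableOn_liftSet hf hfi)

/-- **The spin-wave sector as a sum over winding sectors** (closed cube `[0,2π]^Λ`, which differs from the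
half-open one by a null set). [folklore] -/
theorem setIntegral_cubeIcc_vortexFree_eq_tsum [Fintype Λ] (f : (Λ → ℝ) → E)
    (hf : ∀ (n : Λ → ℤ) (φ : Λ → ℝ), f (fun x => φ x + n x • (2 * π)) = f φ)
    (hfi : IntegrableOn f (cubeIcc Λ) volume) :
    ∫ φ in cubeIcc Λ ∩ F.vortexFreeSet, f φ = ∑' k : Fin d → ℤ, ∫ φ in F.liftDom k, f φ := by
  have hae : (cubeIcc Λ ∩ F.vortexFreeSet : Set (Λ → ℝ)) =ᵐ[volume] (cubeIco Λ ∩ F.vortexFreeSet : Set (Λ → ℝ)) :=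
    (cubeIco_ae_eq_cubeIcc (Λ := Λ)).symm.inter (ae_eq_refl F.vortexFreeSet)
  rw [setIntegral_congr_set hae]
  exact F.setIntegral_cubeIco_vortexFree_eq_tsum f hf (hfi.congr_set_ae (cubeIco_ae_eq_cubeIcc (Λ := Λ)))

end TorusChart

end Literature.MathematicalPhysics.QuantumFieldTheory

end
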